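import Literature.NumberTheory.NumberFields.UnitRankZeroPowerClasses
import Mathlib.NumberTheory.NumberField.Cyclotomic.PID
import HarnessLib

/-!
# `K(∅, n) = 1` for the Eisenstein field `ℚ(ζ₃) = ℚ(√-3)` and `n` prime to `6`: an element of `ℚ(ζ₃)ˣ`
# all of whose valuations are divisible by `n` is an `n`-th power

PROOF-ONLY file (theorems only, no definition, no named fact, no `sorry`), topic
`NumberTheory/NumberFields`; the `ℚ(ζ₃)`-twin of the tree's `UnitRankZeroPowerClasses` §3 (`ℚ(ζ₄)`).
The general §2 of that file proves: `𝓞_K` principal, unit rank `r₁ + r₂ − 1 = 0` and `gcd(n, w_K) = 1`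
⟹ a nonzero algebraic integer all of whose prime exponents are divisible by `n` is an `n`-th power.
Here `K = ℚ(ζ₃)` (any `K` with `IsCyclotomicExtension {3} ℚ K`): `𝓞_K = ℤ[ζ₃]` is principal (Mathlib
`IsCyclotomicExtension.Rat.three_pid`), the unit rank is `0 + 1 − 1 = 0`, and `w_K = #μ(ℚ(ζ₃)) = 6`
(units `±1, ±ζ₃, ±ζ₃²`), so the conclusion holds for every `n` prime to `6` — in particular `n = 5`,
the kernel `K(∅, 5) = 1` of the `μ₅`-box of the `5`-descent on the Kubert–Tate family `E_{m,n} ⊗ ℚ(ζ₃)`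
(the Eisenstein twin of the tree's descent over `ℚ(i)`; instrument for stmt-BirchSwinnertonDyer-22356,
BSD is not proved by any of this).

* `rank_eq_zero_of_isCyclotomicExtension_three` (private) — unit rank `0`; `torsionOrder_eq_six` — `w = 6`;
* **`exists_eq_pow_of_forall_count_dvd_three`** — `gcd(6, n) = 1`, `a ∈ ℤ[ζ₃] ∖ 0` with `n ∣ v(a)` for all
  `v` ⟹ `a = gⁿ`; field form **`exists_eq_pow_of_forall_dvd_log_valuation_three`** (`x ∈ ℚ(ζ₃)ˣ`).

## References

* [SilvermanAEC2009] J. H. Silverman, *The Arithmetic of Elliptic Curves*, 2nd ed., Prop. VIII.1.6,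
  Thm. X.1.1(c).
* [NeukirchANT1999] J. Neukirch, *Algebraic Number Theory*, Ch. I §7 Thm. (7.4) (Dirichlet).
* [Washington1997] L. C. Washington, *Introduction to Cyclotomic Fields*, 2nd ed., Ch. 1 (roots of
  unity of `ℚ(ζ_n)`: `μ_{2n}` for odd `n`); Ch. 11 (class number one of `ℚ(ζ₃)`).
-/

noncomputable section

open NumberField NumberField.Units NumberField.InfinitePlace IsDedekindDomain Ideal

namespace Literature.NumberTheory.NumberFields

section Three

variable {K : Type} [Field K] [NumberField K] [IsCyclotomicExtension {3} ℚ K]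

/-- `ℚ(ζ₃)` has unit rank `r₁ + r₂ − 1 = 0 + 1 − 1 = 0` (private: the statement prints like its `ℚ(ζ₄)`
twin `rank_eq_zero_of_isCyclotomicExtension_four`). [cite: NeukirchANT1999, Ch. I §7 Thm. (7.4)] -/
private theorem rank_eq_zero_of_isCyclotomicExtension_three : rank K = 0 := by
  dsimp only [rank]
  rw [card_eq_nrRealPlaces_add_nrComplexPlaces,
    IsCyclotomicExtension.Rat.nrRealPlaces_eq_zero (n := 3) K (by decide), zero_add,
    IsCyclotomicExtension.Rat.nrComplexPlaces_eq_totient_div_two (n := 3)]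
  rfl

/-- `w_{ℚ(ζ₃)} = #μ(ℚ(ζ₃)) = 6` (`n = 3` odd: `μ(ℚ(ζ_n)) = μ_{2n}`). [cite: Washington1997, Ch. 1 (roots of unity in ℚ(ζ_n))] -/
theorem torsionOrder_eq_six : torsionOrder K = 6 := by
  rw [IsCyclotomicExtension.Rat.torsionOrder_eq (n := 3) (K := K)]
  decide

/-- **`ℚ(ζ₃)(∅, n) = 1` for `n` prime to `6`**: a nonzero Eisenstein integer (element of
`𝓞_{ℚ(ζ₃)} = ℤ[ζ₃]`) all of whose prime exponents are divisible by `n`, `gcd(6, n) = 1`, is an `n`-th power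
in `ℤ[ζ₃]` (`ℤ[ζ₃]` principal — Mathlib `IsCyclotomicExtension.Rat.three_pid` —, units `±ζ₃^i` of order `6`
prime to `n`). [cite: SilvermanAEC2009, Prop. VIII.1.6] [cite: NeukirchANT1999, Ch. I §7 Thm. (7.4)] -/
theorem exists_eq_pow_of_forall_count_dvd_three {n : ℕ} (hn : Nat.Coprime 6 n) {a : 𝓞 K} (ha : a ≠ 0)
    (hdvd : ∀ v : HeightOneSpectrum (𝓞 K),
      n ∣ (Associates.mk v.asIdeal).count (Associates.mk (Ideal.span {a})).factors) :
    ∃ g : 𝓞 K, a = g ^ n := by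
  haveI : IsPrincipalIdealRing (𝓞 K) := IsCyclotomicExtension.Rat.three_pid K
  refine exists_eq_pow_of_forall_count_dvd_of_rank_eq_zero
    rank_eq_zero_of_isCyclotomicExtension_three ?_ ha hdvd
  rw [torsionOrder_eq_six]
  exact hn

/-- **`ℚ(ζ₃)(∅, n) = 1`, field form**: a nonzero `x ∈ ℚ(ζ₃)` whose valuation at every finite place is
divisible by `n`, `gcd(6, n) = 1` (`n ∣ v(x)` for all `v`), is an `n`-th power in `ℚ(ζ₃)` — write `x = a/b`
with `a, b ∈ ℤ[ζ₃]`, then `a bⁿ⁻¹` has all prime exponents divisible by `n`.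
[cite: SilvermanAEC2009, Prop. VIII.1.6 and Thm. X.1.1(c)] -/
theorem exists_eq_pow_of_forall_dvd_log_valuation_three {n : ℕ} (hn : Nat.Coprime 6 n) {x : K}
    (hx : x ≠ 0) (hdvd : ∀ v : HeightOneSpectrum (𝓞 K), (n : ℤ) ∣ WithZero.log (v.valuation K x)) :
    ∃ y : K, x = y ^ n := by
  have hn0 : n ≠ 0 := by
    rintro rfl
    norm_num at hn
  obtain ⟨a, b, hb, hab⟩ := IsFractionRing.div_surjective (A := 𝓞 K) x
  have hb0 : (b : 𝓞 K) ≠ 0 := nonZeroDivisors.ne_zero hb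
  have hbK : (algebraMap (𝓞 K) K b) ≠ 0 :=
    fun h ↦ hb0 ((FaithfulSMul.algebraMap_injective (𝓞 K) K) (by rw [h, map_zero]))
  have ha0 : a ≠ 0 := by
    rintro rfl
    rw [map_zero, zero_div] at hab
    exact hx hab.symm
  set c : 𝓞 K := a * b ^ (n - 1) with hc
  have hc0 : c ≠ 0 := mul_ne_zero ha0 (pow_ne_zero _ hb0)
  have hcK : algebraMap (𝓞 K) K c = x * (algebraMap (𝓞 K) K b) ^ n := by
    rw [hc, map_mul, map_pow, ← hab]
    obtain ⟨k, hk⟩ := Nat.exists_eq_succ_of_ne_zero hn0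
    rw [hk, Nat.succ_sub_one, pow_succ]
    field_simp
  -- every prime exponent of `c` is divisible by `n`
  have hcdvd : ∀ v : HeightOneSpectrum (𝓞 K),
      n ∣ (Associates.mk v.asIdeal).count (Associates.mk (Ideal.span {c})).factors := by
    intro v
    have hvx : v.valuation K x ≠ 0 := (Valuation.ne_zero_iff _).mpr hx
    have hvb : v.valuation K (algebraMap (𝓞 K) K b) ≠ 0 := (Valuation.ne_zero_iff _).mpr hbK
    have h1 : WithZero.log (v.valuation K (algebraMap (𝓞 K) K c)) =
        WithZero.log (v.valuation K x) + n • WithZero.log (v.valuation K (algebraMap (𝓞 K) K b)) := by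
      rw [hcK, map_mul, map_pow, WithZero.log_mul hvx (pow_ne_zero _ hvb), WithZero.log_pow]
    have h2 : WithZero.log (v.valuation K (algebraMap (𝓞 K) K c)) =
        -((Associates.mk v.asIdeal).count (Associates.mk (Ideal.span {c})).factors : ℤ) := by
      rw [HeightOneSpectrum.valuation_of_algebraMap, HeightOneSpectrum.intValuation_if_neg _ hc0,
        WithZero.log_exp]
    obtain ⟨k, hk⟩ := hdvd v
    have h3 : ((Associates.mk v.asIdeal).count (Associates.mk (Ideal.span {c})).factors : ℤ) =
        (n : ℤ) * (-k - WithZero.log (v.valuation K (algebraMap (𝓞 K) K b))) := by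
      have := h2.symm.trans h1
      rw [hk, nsmul_eq_mul] at this
      linarith
    have h4 : (n : ℤ) ∣ ((Associates.mk v.asIdeal).count (Associates.mk (Ideal.span {c})).factors : ℤ) :=
      ⟨_, h3⟩
    exact Int.natCast_dvd_natCast.mp h4
  obtain ⟨g, hg⟩ := exists_eq_pow_of_forall_count_dvd_three hn hc0 hcdvd
  refine ⟨algebraMap (𝓞 K) K g / algebraMap (𝓞 K) K b, ?_⟩
  rw [div_pow, ← map_pow, ← hg, hcK, mul_div_assoc, div_self (pow_ne_zero _ hbK), mul_one]

end Three

end Literature.NumberTheory.NumberFields
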